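import Summits.AtomisticToContinuum.FouriersLaw.Theorems.EmbeddedDrudeMourreMourreDissolutionGibbsMixing
import Summits.AtomisticToContinuum.FouriersLaw.Theorems.HoelderEscapeProfileAbelSpreadCeilingFixedTimeRegularity
import Literature.MathematicalPhysics.KineticTheory.InfiniteChainShiftInvariantUniqueness
import Literature.MathematicalPhysics.KineticTheory.InfiniteChainGibbsMomentaIndependence
import Literature.MathematicalPhysics.KineticTheory.InfiniteChainEnergyDensityMoments
import Literature.MathematicalPhysics.KineticTheory.InfiniteChainCovarianceMixingBox
import Literature.MathematicalPhysics.KineticTheory.InfiniteChainGoodSetSymmetries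
import Literature.MathematicalPhysics.KineticTheory.FluctuationFoelnerPositivity
import Literature.MathematicalPhysics.KineticTheory.TransportRegularityOfMixing
import Literature.Probability.Distributions.GaussianMoments
import HarnessLib

/-!
# Stub A `stub_staticStructureFactor` of line `Sketch` (canonical reduction), crux `FibreCalculus`
# of route `HoelderEscapeProfile` (stmt-AtomisticToContinuum-16011): statics of the energy density

Clauses (5), (6) of the crux. For the pinned anharmonic chain `P = pinnedChain ω₂ lam β γ`
(`ω₂, lam, β > 0`), `T > 0`, and a shift-invariant DLR state `μ`, the split-bond energy density
`h_x = p_x²/2 + U(q_x) + (V(q_{x+1} - q_x) + V(q_x - q_{x-1}))/2` (`OscillatorChain.energyDensityZ`)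
has static two-point function `S₀(x) = ∫ (h_0 - ⟨h_0⟩)(h_x - ⟨h_0⟩) dμ = Cov_μ(h_0, h_0 ∘ τ_x)` with
`Σ_x (1 + x²) |S₀(x)| < ∞` and `0 < Σ_x S₀(x)`. No dynamics enters.

* (5) The shift-invariant DLR state is unique
  (`eq_of_isChainGibbsMeasure_of_isShiftInvariant_pinnedChain`), hence equals the exponentially
  ρ-mixing transfer-operator state of `MourreDissolution.exists_gibbsState_mixing_pinnedChain`;
  the box form of mixing (`abs_covariance_comp_chainShift_le_of_mixing`) bounds
  `|Cov(h_0, h_0 ∘ τ_x)| ≤ K e^{-m(|x|-2)₊}`, and `Σ (1+x²) e^{-m(|x|-2)₊} < ∞` (the tree's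
  `AbelSpreadCeiling.RegularityCollapse.summable_one_add_sq_mul_abs_covariance_of_mixing`).
* (6) `h_x = k_x + c_x`, `k_x = p_x²/2`, `c_x` a function of the positions. Under a DLR state each
  momentum is `N(0,T)`, independent of the position field (`IsChainGibbsMeasure.indepFun_snd_fst`,
  `map_snd`) and of the other momenta (`ssf_indepFun_snd_snd`), so
  `Cov(h_0, h_x) = Var(p²/2)·[x = 0] + Cov(c_0, c_x)` with `Var(p²/2) = T²/2`
  (`ssf_variance_sq_div_two_gaussianReal`), and `Σ_x Cov(c_0, c_0 ∘ τ_x) ≥ 0` by the Følner /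
  Fejér average `tsum_covariance_comp_shift_nonneg` (`FluctuationFoelnerPositivity`). Hence
  `Σ_x S₀(x) ≥ T²/2 > 0`.

## Contents
* `ssf_summable_of_weight_mul_abs` — a `(1 + x²)`-weighted absolutely summable sequence is summable;
* `ssf_indepFun_snd_snd`, `ssf_variance_sq_div_two_gaussianReal` — the momenta of a DLR state;
* `ssf_staticStructureFactor_energyDensityZ` — (5), (6) for `energyDensityZ`;
* `stub_staticStructureFactor` — the registered stub, verbatim.
-/

noncomputable section

open MeasureTheory ProbabilityTheory Filter Topology Set Function
open scoped ENNReal NNReal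

namespace Summit.AtomisticToContinuum.FouriersLaw.Theorems.FibreCalculusSketch

open Literature.MathematicalPhysics.KineticTheory.HeatConduction
open Literature.MathematicalPhysics.KineticTheory.HeatConduction.OscillatorChain
open Literature.Probability.Distributions (integral_pow_even_gaussianReal integrable_pow_gaussianReal)
open Summit.AtomisticToContinuum.FouriersLaw.Theorems.AbelSpreadCeiling.RegularityCollapse
  (summable_one_add_sq_mul_abs_covariance_of_mixing)

/-! ### §1 Weighted summability -/

/-- A sequence `c` on `ℤ` with `Σ (1 + x²) |c x| < ∞` is summable. [folklore] -/
theorem ssf_summable_of_weight_mul_abs {c : ℤ → ℝ}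
    (h : Summable fun x : ℤ => (1 + (x : ℝ) ^ 2) * |c x|) : Summable c :=
  Summable.of_abs (Summable.of_nonneg_of_le (fun x => abs_nonneg _)
    (fun x => le_mul_of_one_le_left (abs_nonneg _) (by nlinarith [sq_nonneg (x : ℝ)])) h)

/-! ### §2 The momenta of a DLR state: pairwise independence and `Var(p²/2) = T²/2` -/

/-- **Distinct momenta of a DLR state are independent**: for `i ≠ j`, `p_i ⟂ p_j` under every DLR
state at `T > 0` (`U`, `V` continuous) — the one-site factorisation
`IsChainGibbsMeasure.lintegral_snd_mul` with `φ = 𝟙_s`, `G = 𝟙_t(p_j)` (which does not read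
`p_i`) and the marginal law `IsChainGibbsMeasure.map_snd` (Lanford–Lebowitz–Lieb 1977, §4
remark (ii): the `p_i` are i.i.d. `N(0,T)`). [folklore] -/
theorem ssf_indepFun_snd_snd {P : OscillatorChain} (hU : Continuous P.U) (hV : Continuous P.V)
    {T : ℝ} (hT : 0 < T) {μ : Measure ChainConfig} (hμ : P.IsChainGibbsMeasure T μ) {i j : ℤ}
    (hij : i ≠ j) :
    IndepFun (fun σ : ChainConfig => (σ i).2) (fun σ : ChainConfig => (σ j).2) μ := by
  haveI : IsProbabilityMeasure μ := hμ.1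
  have hπi : Measurable fun σ : ChainConfig => (σ i).2 := (measurable_pi_apply i).snd
  have hπj : Measurable fun σ : ChainConfig => (σ j).2 := (measurable_pi_apply j).snd
  rw [indepFun_iff_measure_inter_preimage_eq_mul]
  intro s t hs ht
  have hG : Measurable fun σ : ChainConfig => t.indicator (1 : ℝ → ℝ≥0∞) (σ j).2 :=
    (measurable_one.indicator ht).comp hπj
  have h := hμ.lintegral_snd_mul hU hV hT i (measurable_one.indicator hs) hG (fun σ p => by
    simp only [Function.update_of_ne hij.symm])
  have hR : ∫⁻ σ : ChainConfig, t.indicator (1 : ℝ → ℝ≥0∞) (σ j).2 ∂μ =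
      μ ((fun σ : ChainConfig => (σ j).2) ⁻¹' t) := by
    rw [← lintegral_indicator_one (ht.preimage hπj)]
    exact lintegral_congr fun σ => by by_cases h2 : (σ j).2 ∈ t <;> simp [h2]
  rw [lintegral_indicator_one hs, hR, ← hμ.map_snd hU hV hT i, Measure.map_apply hπi hs] at h
  rw [← h, ← lintegral_indicator_one ((hs.preimage hπi).inter (ht.preimage hπj))]
  refine lintegral_congr fun σ => ?_
  by_cases h1 : (σ i).2 ∈ s <;> by_cases h2 : (σ j).2 ∈ t <;> simp [h1, h2]

/-- `Var(p²/2) = T²/2` for `p ∼ N(0,T)`: `E p⁴ = 3T²`, `E p² = T` (Gaussian moments,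
`integral_pow_even_gaussianReal`). [folklore] -/
theorem ssf_variance_sq_div_two_gaussianReal {T : ℝ} (hT : 0 ≤ T) :
    Var[fun s : ℝ => s ^ 2 / 2; gaussianReal 0 T.toNNReal] = T ^ 2 / 2 := by
  -- adapted from `variance_kinetic_pi_gaussian` (HeatModeWeylLawSpecificHeatLimit)
  have hv : ((T.toNNReal : ℝ≥0) : ℝ) = T := Real.coe_toNNReal T hT
  have hX : MemLp (fun s : ℝ => s ^ 2 / 2) 2 (gaussianReal 0 T.toNNReal) := by
    rw [memLp_two_iff_integrable_sq (by fun_prop)]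
    refine ((integrable_pow_gaussianReal 0 T.toNNReal 4).div_const 4).congr
      (ae_of_all _ fun s => ?_)
    dsimp only
    ring
  rw [variance_eq_sub hX]
  have h4 : ∫ s, ((fun s : ℝ => s ^ 2 / 2) ^ 2) s ∂(gaussianReal 0 T.toNNReal) = 3 * T ^ 2 / 4 := by
    have e : ((fun s : ℝ => s ^ 2 / 2) ^ 2) = fun s : ℝ => (1 / 4 : ℝ) * s ^ (2 * 2) := by
      funext s; simp only [Pi.pow_apply]; ring
    rw [e, integral_const_mul, integral_pow_even_gaussianReal, hv]
    norm_num [Nat.doubleFactorial]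
    ring
  have h2 : ∫ s, (fun s : ℝ => s ^ 2 / 2) s ∂(gaussianReal 0 T.toNNReal) = T / 2 := by
    have e : (fun s : ℝ => s ^ 2 / 2) = fun s : ℝ => (1 / 2 : ℝ) * s ^ (2 * 1) := by
      funext s; ring
    rw [e, integral_const_mul, integral_pow_even_gaussianReal, hv]
    norm_num [Nat.doubleFactorial]
    ring
  rw [h4, h2]
  ring

/-! ### §3 The static structure factor of the pinned anharmonic chain -/

/-- **Statics of the split-bond energy density of the pinned anharmonic chain** (clauses (5), (6)
of the crux for `h_x = OscillatorChain.energyDensityZ σ x`). For `ω₂ > 0`, `lam, β ≥ 0`, `T > 0` and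
a shift-invariant DLR state `μ` of `pinnedChain ω₂ lam β γ`, with
`S₀(x) = ∫ (h_0 - ⟨h_0⟩)(h_x - ⟨h_0⟩) dμ`: `Σ_x (1 + x²) |S₀(x)| < ∞` (exponential ρ-mixing of the
unique shift-invariant DLR state) and `0 < Σ_x S₀(x)`
(`= T²/2 + Σ_x Cov(c_0, c_0 ∘ τ_x) ≥ T²/2`: i.i.d. Gaussian momenta independent of the positions,
and Følner positivity of the configurational part). [folklore] -/
theorem ssf_staticStructureFactor_energyDensityZ {ω₂ lam β : ℝ} (γ : ℝ) (hω : 0 < ω₂)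
    (hl : 0 ≤ lam) (hβ : 0 ≤ β) {T : ℝ} (hT : 0 < T) {μ : Measure ChainConfig}
    (hG : (pinnedChain ω₂ lam β γ).IsChainGibbsMeasure T μ) (hSI : IsShiftInvariant μ) :
    Summable (fun x : ℤ => (1 + (x : ℝ) ^ 2) *
      |∫ σ, ((pinnedChain ω₂ lam β γ).energyDensityZ σ 0 -
          ∫ σ', (pinnedChain ω₂ lam β γ).energyDensityZ σ' 0 ∂μ) *
        ((pinnedChain ω₂ lam β γ).energyDensityZ σ x -
          ∫ σ', (pinnedChain ω₂ lam β γ).energyDensityZ σ' 0 ∂μ) ∂μ|) ∧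
    0 < ∑' x : ℤ, ∫ σ, ((pinnedChain ω₂ lam β γ).energyDensityZ σ 0 -
          ∫ σ', (pinnedChain ω₂ lam β γ).energyDensityZ σ' 0 ∂μ) *
        ((pinnedChain ω₂ lam β γ).energyDensityZ σ x -
          ∫ σ', (pinnedChain ω₂ lam β γ).energyDensityZ σ' 0 ∂μ) ∂μ := by
  -- the shift-invariant DLR state is the exponentially mixing transfer-operator state
  obtain ⟨μ', hG', hS', hss, -, C, m, hm, hmix⟩ :=
    MourreDissolution.exists_gibbsState_mixing_pinnedChain ω₂ lam β γ hω hl hβ T hT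
  have hμμ' : μ = μ' :=
    eq_of_isChainGibbsMeasure_of_isShiftInvariant_pinnedChain γ hω hl hβ hT hG hSI hG' hS'
  subst hμμ'
  set P := pinnedChain ω₂ lam β γ with hP
  haveI : IsProbabilityMeasure μ := hG.1
  have hτ : ∀ x : ℤ, MeasurePreserving (chainShift x) μ μ := hSI.measurePreserving_chainShift
  have hUc : Continuous P.U := by
    show Continuous fun q : ℝ => ω₂ * q ^ 2 / 2 + lam * q ^ 4 / 4
    fun_prop
  have hVc : Continuous P.V := by
    show Continuous fun r : ℝ => r ^ 2 / 2 + β * r ^ 4 / 4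
    fun_prop
  have hU0 : ∀ q, 0 ≤ P.U q := pinnedChain_U_nonneg β γ hω.le hl
  have hV0 : ∀ r, 0 ≤ P.V r := pinnedChain_V_nonneg ω₂ lam γ hβ
  have hhm : ∀ x, Measurable fun σ : ChainConfig => P.energyDensityZ σ x :=
    P.measurable_energyDensityZ hUc.measurable hVc.measurable
  have hh2 : ∀ x, MemLp (fun σ : ChainConfig => P.energyDensityZ σ x) 2 μ := fun x =>
    memLp_energyDensityZ_pinnedChain γ hω.le hl hβ hss x ENNReal.ofNat_ne_top
  have hhd : DependsOn (fun σ : ChainConfig => P.energyDensityZ σ 0)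
      (Set.Icc (-((1 : ℕ) : ℤ)) ((1 : ℕ) : ℤ)) := by
    simpa only [Nat.cast_one] using P.dependsOn_energyDensityZ_zero
  -- `S₀(x) = Cov(h₀, h₀ ∘ τ_x)`
  have hmean : ∀ x, ∫ σ, P.energyDensityZ σ x ∂μ = ∫ σ, P.energyDensityZ σ 0 ∂μ := fun x => by
    rw [← integral_comp_chainShift (hτ x) (hhm 0).aestronglyMeasurable]
    simp only [energyDensityZ_chainShift, zero_add]
  have hS0 : ∀ x : ℤ, ∫ σ, (P.energyDensityZ σ 0 - ∫ σ', P.energyDensityZ σ' 0 ∂μ) *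
      (P.energyDensityZ σ x - ∫ σ', P.energyDensityZ σ' 0 ∂μ) ∂μ =
      cov[fun σ => P.energyDensityZ σ 0, (fun σ => P.energyDensityZ σ 0) ∘ chainShift x; μ] :=
    fun x => by
    simp only [covariance, comp_apply, energyDensityZ_chainShift, zero_add, hmean x]
  simp only [hS0]
  refine ⟨summable_one_add_sq_mul_abs_covariance_of_mixing hmix hm hτ hhd (hhm 0) (hh2 0), ?_⟩
  -- kinetic / configurational split `h_x = k_x + c_x`
  set kin : ℤ → ChainConfig → ℝ := fun x σ => (σ x).2 ^ 2 / 2 with hkin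
  set gc : ℤ → (ℤ → ℝ) → ℝ := fun x q =>
    P.U (q x) + (P.V (q (x + 1) - q x) + P.V (q x - q (x - 1))) / 2 with hgc
  set cfg : ℤ → ChainConfig → ℝ := fun x σ => gc x fun y => (σ y).1 with hcfg
  have hdec : ∀ x, (fun σ : ChainConfig => P.energyDensityZ σ x) = kin x + cfg x := fun x => by
    funext σ
    simp only [hkin, hcfg, hgc, Pi.add_apply, energyDensityZ]
    ring
  have hpt : ∀ x σ, P.energyDensityZ σ x = kin x σ + cfg x σ := fun x σ => congrFun (hdec x) σ
  have hkin0 : ∀ x σ, 0 ≤ kin x σ := fun x σ => by simp only [hkin]; positivity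
  have hcfg0 : ∀ x σ, 0 ≤ cfg x σ := fun x σ => by
    have h1 := hU0 (σ x).1
    have h2 := hV0 ((σ (x + 1)).1 - (σ x).1)
    have h3 := hV0 ((σ x).1 - (σ (x - 1)).1)
    simp only [hcfg, hgc]
    positivity
  have hq : ∀ y : ℤ, Measurable fun q : ℤ → ℝ => q y := fun y => measurable_pi_apply y
  have hp : ∀ x : ℤ, Measurable fun σ : ChainConfig => (σ x).2 := fun x =>
    (measurable_pi_apply x).snd
  have hgcm : ∀ x, Measurable (gc x) := fun x =>
    (hUc.measurable.comp (hq x)).add (((hVc.measurable.comp ((hq (x + 1)).sub (hq x))).add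
      (hVc.measurable.comp ((hq x).sub (hq (x - 1))))).div_const 2)
  have hcfgm : ∀ x, Measurable (cfg x) := fun x => (hgcm x).comp measurable_positionField
  have hkinm : ∀ x, Measurable (kin x) := fun x => ((hp x).pow_const 2).div_const 2
  have hkin2 : ∀ x, MemLp (kin x) 2 μ := fun x =>
    (hh2 x).of_le (hkinm x).aestronglyMeasurable (Eventually.of_forall fun σ => by
      show ‖kin x σ‖ ≤ ‖P.energyDensityZ σ x‖
      rw [Real.norm_of_nonneg (hkin0 x σ), Real.norm_of_nonneg (energyDensityZ_nonneg hU0 hV0 σ x),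
        hpt]
      linarith [hcfg0 x σ])
  have hcfg2 : ∀ x, MemLp (cfg x) 2 μ := fun x =>
    (hh2 x).of_le (hcfgm x).aestronglyMeasurable (Eventually.of_forall fun σ => by
      show ‖cfg x σ‖ ≤ ‖P.energyDensityZ σ x‖
      rw [Real.norm_of_nonneg (hcfg0 x σ), Real.norm_of_nonneg (energyDensityZ_nonneg hU0 hV0 σ x),
        hpt]
      linarith [hkin0 x σ])
  have hcfgd : DependsOn (cfg 0) (Set.Icc (-((1 : ℕ) : ℤ)) ((1 : ℕ) : ℤ)) := by
    intro σ σ' hσσ'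
    have e0 : σ 0 = σ' 0 := hσσ' 0 (by norm_num)
    have e1 : σ (0 + 1) = σ' (0 + 1) := hσσ' (0 + 1) (by norm_num)
    have e2 : σ (0 - 1) = σ' (0 - 1) := hσσ' (0 - 1) (by norm_num)
    simp only [hcfg, hgc, e0, e1, e2]
  -- the momenta: independent of the positions and of each other, `Var(p₀²/2) = T²/2`
  have hkc : ∀ i x, cov[kin i, cfg x; μ] = 0 := fun i x =>
    ((hG.indepFun_snd_fst hUc hVc hT i).comp (φ := fun p : ℝ => p ^ 2 / 2) (ψ := gc x)
      (by fun_prop) (hgcm x)).covariance_eq_zero (hkin2 i) (hcfg2 x)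
  have hvar : Var[kin 0; μ] = T ^ 2 / 2 := by
    have h := variance_map (μ := μ) (X := fun s : ℝ => s ^ 2 / 2)
      (Y := fun σ : ChainConfig => (σ 0).2) (by fun_prop) (hp 0).aemeasurable
    rw [hG.map_snd hUc hVc hT 0, ssf_variance_sq_div_two_gaussianReal hT.le] at h
    exact h.symm
  have hkk : ∀ x, cov[kin 0, kin x; μ] = if x = 0 then T ^ 2 / 2 else 0 := fun x => by
    split_ifs with hx
    · rw [hx, covariance_self (hkinm 0).aemeasurable, hvar]
    · exact ((ssf_indepFun_snd_snd hUc hVc hT hG (Ne.symm hx)).comp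
        (φ := fun p : ℝ => p ^ 2 / 2) (ψ := fun p : ℝ => p ^ 2 / 2) (by fun_prop)
        (by fun_prop)).covariance_eq_zero (hkin2 0) (hkin2 x)
  have hshift : ∀ x, cfg 0 ∘ chainShift x = cfg x := fun x => by
    funext σ
    have e1 := hpt 0 (chainShift x σ)
    rw [energyDensityZ_chainShift, zero_add, hpt x σ] at e1
    have e2 : kin 0 (chainShift x σ) = kin x σ := by simp only [hkin, chainShift_apply, zero_add]
    simp only [comp_apply]
    linarith
  -- `Cov(h₀, h₀ ∘ τ_x) = T²/2 · [x = 0] + Cov(c₀, c₀ ∘ τ_x)`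
  have hcov : ∀ x, cov[fun σ => P.energyDensityZ σ 0, (fun σ => P.energyDensityZ σ 0) ∘ chainShift x; μ]
      = (if x = 0 then T ^ 2 / 2 else 0) + cov[cfg 0, cfg 0 ∘ chainShift x; μ] := fun x => by
    rw [energyDensityZ_comp_chainShift, hdec 0, hdec x,
      covariance_add_left (hkin2 0) (hcfg2 0) ((hkin2 x).add (hcfg2 x)),
      covariance_add_right (hkin2 0) (hkin2 x) (hcfg2 x),
      covariance_add_right (hcfg2 0) (hkin2 x) (hcfg2 x), hkk x, hkc 0 x,
      covariance_comm (cfg 0) (kin x), hkc x 0, hshift x]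
    ring
  simp_rw [hcov]
  have hite : HasSum (fun x : ℤ => if x = 0 then T ^ 2 / 2 else (0 : ℝ)) (T ^ 2 / 2) :=
    hasSum_ite_eq 0 _
  have hsumc : Summable fun x : ℤ => cov[cfg 0, cfg 0 ∘ chainShift x; μ] :=
    ssf_summable_of_weight_mul_abs
      (summable_one_add_sq_mul_abs_covariance_of_mixing hmix hm hτ hcfgd (hcfgm 0) (hcfg2 0))
  have hA : 0 ≤ ∑' x : ℤ, cov[cfg 0, cfg 0 ∘ chainShift x; μ] :=
    Literature.MathematicalPhysics.KineticTheory.tsum_covariance_comp_shift_nonneg chainShift hτ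
      (hcfg2 0) hsumc
  rw [hite.summable.tsum_add hsumc, hite.tsum_eq]
  have hT2 : 0 < T ^ 2 / 2 := by positivity
  linarith

/-- **STUB A `stub_staticStructureFactor` (registered signature, verbatim): statics of the
split-bond energy density.** For the pinned anharmonic chain `pinnedChain ω₂ lam β γ`
(`ω₂, lam, β > 0`), `T > 0`, a shift-invariant (and momentum-reversal-invariant — not used) DLR
state `μ`, `h_x = p_x²/2 + U(q_x) + (V(q_{x+1} - q_x) + V(q_x - q_{x-1}))/2` and
`S₀(x) = ∫ (h_0 - ⟨h_0⟩)(h_x - ⟨h_0⟩) dμ`: `Σ_x (1 + x²) |S₀(x)| < ∞` and `0 < Σ_x S₀(x)`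
(`ssf_staticStructureFactor_energyDensityZ`, `h_x` being literally `energyDensityZ`).
[cite: Georgii2011, Thm 10.25 and §11.1] [cite: BonettoLebowitzReyBellet2000, §7] -/
theorem stub_staticStructureFactor :
    ∀ ω₂ lam β γ : ℝ, 0 < ω₂ → 0 < lam → 0 < β → ∀ T : ℝ, 0 < T →
    ∀ μ : Measure ChainConfig, (pinnedChain ω₂ lam β γ).IsChainGibbsMeasure T μ → IsShiftInvariant μ →
    μ.map (fun σ : ChainConfig => fun x : ℤ => ((σ x).1, -(σ x).2)) = μ →
    ∀ h : ChainConfig → ℤ → ℝ,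
      h = (fun (σ : ChainConfig) (x : ℤ) => (σ x).2 ^ 2 / 2 + (pinnedChain ω₂ lam β γ).U (σ x).1 +
        ((pinnedChain ω₂ lam β γ).V ((σ (x + 1)).1 - (σ x).1) +
          (pinnedChain ω₂ lam β γ).V ((σ x).1 - (σ (x - 1)).1)) / 2) →
    ∀ S₀ : ℤ → ℝ,
      S₀ = (fun x : ℤ => ∫ σ, (h σ 0 - ∫ σ', h σ' 0 ∂μ) * (h σ x - ∫ σ', h σ' 0 ∂μ) ∂μ) →
    Summable (fun x : ℤ => (1 + (x : ℝ) ^ 2) * |S₀ x|) ∧ 0 < ∑' x : ℤ, S₀ x := by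
  intro ω₂ lam β γ hω hl hβ T hT μ hG hSI _ h hh S₀ hS₀
  subst hh
  subst hS₀
  exact ssf_staticStructureFactor_energyDensityZ γ hω hl.le hβ.le hT hG hSI

end Summit.AtomisticToContinuum.FouriersLaw.Theorems.FibreCalculusSketch

end
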